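import Summits.QuantumFields.BalabanUV.T4Continuum.Support.ShellMeasureLinearizedGammaTLocal

/-!
# `T4Continuum.ShellMeasureLinearizedGammaTLocalEnd` — NE7c, audit γ3′ «THE REGULARITY HALF OF (LR)_j IS LOCAL», file 2∕2:
# W-d's (LR)_j END (row S52 `realForm_chartData_gammaT`) RE-CONCLUDED AT A COARSE BOND `c` FROM THE LOOP ∕ PLAQUETTE
# REGULARITY OF THE BACKGROUND ON ITS OWN TWO-BLOCK BOX `B(c₋) ∪ B(c₊)` — NOTHING OUTSIDE
(cell `pub-balaban`, sub-cell `t4`, spine estimate NE7c (node U5b); NE7c ROUND-2 crew `t4-ne7c-formalise-*`, seat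
`b2b-balaban-t4-ne7c-formalise-leaf-07` gen 8, own initiative (journal OFFER l.18240, FINDING-CANDIDATE
F-ne7cleaf07g8-1); imports file 1 `ShellMeasureLinearizedGammaTLocal` ONLY (hence S52 f2 + `ShellMeasureAverageAnalyticRegular`),
everything BY NAME; [folklore]; 0 `def` (two reducible `abbrev`s naming file 1's objects on the regular box), 0
`def … : Prop`, 0 sorry, 0 citations)

HONEST FRAMING.  Finite four-torus programme, rung (B)+1 only — NOT infinite volume, NOT a mass gap, NOT the Clay
problem, NOT summit progress; (B), `BetaPertHyp`, (B^μ) not consumed.  NE7c (`T4IndicatorShell.ShellWeightBound`) is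
NOT PRINTED and NOT PROVED; «NE7c ⇐ the named binders» (trigger c3).  Nothing of [Balaban 1983–89] is asserted or
discharged: the background's plaquette regularity (B11 (19)–(21) ∕ B14 (2.16)–(2.17) ∕ [B12] p. 254 TYPE) stays a
DISPLAYED binder — this file only LOCATES it (two-block box instead of all of `ℤᵈ`).  NOTHING in the countdown moves;
spine PROVED 0∕9.  HONEST DEPENDENCY (cell, verbatim): continuum YM on T⁴ ⇐ BetaPertH ∧ nine spine estimates (0/9
proved); BetaPertH ⇐ (D1) ∧ (D4) ∧ CAP+tail; G-an2-4 gates asym, D1 and NE2/3/4.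

CONTENT.  §3 **`exists_splitting_gammaT_local`**, **`realForm_chartData_gammaT_local`** = S52's END (the SAME six
clauses: `D̃` in the ball, print's fixed-point equation, `Q̃(B − h D̃B) = DQ̃(0)B`, measurable ∕ InjOn ∕ HasFDerivWithinAt ∕
linearizes on the Hermitian window) with the loop binder AT `c` ONLY, by S46 `exists_realForm_chartData_of_Q` BY NAME
exactly as S52 f1's core fires it ((Q1)(Q3) S49 f2, (Q4) S52 §1 `QtΓ_conj` — all three already take `hW c` only; `hop` :=
file 1's `hopΓAt`); **`realForm_chartData_gammaT_local_explicit`** (window radius CHOSEN by S52 f1 `window_ok`, splitting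
SUPPLIED — the located binder + unitarity and NOTHING ELSE); `loopsAt_of_box` (B12PlaquetteLoop267's LOCAL form, packaged),
`hopΓBox`∕`hΓBox`, and
**`realForm_chartData_gammaT_local_regular`** — the END from the LOCATED plaquette binder `h44c` (corners in
`[L c₋, L c₋ + pairTop L c.2]`), `24dL^{d+1}ε₀ < 1`.  §4 **`h44c_of_cotests`** — `h44c` read off ANY co-tested plaquette
set `P ⊇ box(c)` (at a live slot: the unit plaquettes of `□^{∼4}`; the identification of the background with Bałaban's
`V = Q(U_{j,□})` is [dict], N-ne7cp1-g32-2 — displayed, not asserted).  WHAT IT CHANGES: the W-d KERNEL half («(Q1)–(Q4)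
kernel UNDER the regularity binder», DV-26) is inhabitable AT A LIVE SLOT from the term's OWN co-tests.
-/

noncomputable section

open Set Metric Filter Topology

namespace Summit.QuantumFields.BalabanUV.T4Continuum.ShellMeasureLinearizedGammaTLocal

open Literature.MathematicalPhysics.QuantumFieldTheory.Balaban1983to89
open Literature.MathematicalPhysics.QuantumLattice (ZdEdge blockSites blockBase plaquetteHolonomyZd)
open B7BlockGeometry (qppBonds)
open B8Lemma1NonAbelian (pairTop omegaC omegaC_nonneg)
open B12HOperator267 (gammaT)
open B12AverageCorridor267 (loopW offAxis mem_blockSites_of_mem_offAxis)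
open B12PlaquetteLoop267 (norm_loopW_sub_one_le_local thresholds_of_small)
open Summit.QuantumFields.BalabanUV.Beta.LinearizingChange267FromQ (nonlin Mq)
open ShellMeasureLinearizedRealStructure (realSub incl reP incl_reP_of_fixed conj_incl reP_incl)
open ShellMeasureLinearizedRealForm (realForm_rightInverse)
open ShellMeasureLinearizedConstraint (exists_splitting_of_rightInverse)
open ShellMeasureLinearizedFromQ (exists_realForm_chartData_of_Q)
open ShellMeasureAverageDerivative (hop_bound_nonneg)
open ShellMeasureAverageAnalyticB7 (analyticOnNhd_Qtilde_gammaT norm_Qtilde_gammaT_le)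
open ShellMeasureLinearizedGammaT (QtΓ QtΓ_zero κ𝔸 κΓ κ𝔸_invol κΓ_invol TΓ winΓ DtΓℝ QtΓ_conj window_ok)

variable {d : ℕ} {𝔸 : Type*} [NormedRing 𝔸] [NormedAlgebra ℂ 𝔸] [NormOneClass 𝔸] [CompleteSpace 𝔸] {L : ℕ}

/-! ## §3a Plaquettes of the box ⇒ loops at `c` (the tree's LOCAL form, packaged) -/

omit [NormedAlgebra ℂ 𝔸] [CompleteSpace 𝔸] in
/-- **PLAQUETTES OF THE BOX ⇒ LOOPS AT `c`** — `B12PlaquetteLoop267`'s LOCAL form, packaged: `‖V(∂p) − 1‖ ≤ ε₀` only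
for the plaquettes with all corners in `[L c₋, L c₋ + pairTop L c.2]` (`= B(c₋) ∪ B(c₊)`) gives the `ω(ε₀)`-regime of
the off-axis block loops AT `c`. [folklore] -/
theorem loopsAt_of_box (hL : 0 < L) (V : ZdEdge d → 𝔸ˣ) (hV : ∀ b, ‖((V b : 𝔸ˣ) : 𝔸)‖ ≤ 1)
    (hV' : ∀ b, ‖(((V b)⁻¹ : 𝔸ˣ) : 𝔸)‖ ≤ 1) {ε₀ : ℝ} (hε₀ : 0 ≤ ε₀) (c : ZdEdge d)
    (h44c : ∀ (p : Fin d → ℤ) (i j : Fin d), i ≠ j → blockBase L c.1 ≤ p →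
      p + Pi.single i 1 + Pi.single j 1 ≤ blockBase L c.1 + pairTop L c.2 →
      ‖((plaquetteHolonomyZd V p i j : 𝔸ˣ) : 𝔸) - 1‖ ≤ ε₀) :
    ∀ x ∈ offAxis L c, ‖((loopW L (fun U : ZdEdge d → 𝔸ˣ => gammaT L U) V c x : 𝔸ˣ) : 𝔸) - 1‖ ≤ omegaC d L ε₀ :=
  fun _ hx => norm_loopW_sub_one_le_local hL V hV hV' hε₀ c h44c (mem_blockSites_of_mem_offAxis hx)

/-! ## §3 THE LOCATED END -/

section End

variable [StarRing 𝔸] [CStarRing 𝔸] [StarModule ℂ 𝔸] {c : ZdEdge d}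

/-- **THE SPLITTING EXISTS, LOCATED** (S52 f1's `exists_splitting_gammaT` with the loops AT `c`). [folklore] -/
theorem exists_splitting_gammaT_local (hL : 0 < L) {V : ZdEdge d → 𝔸ˣ} (hVu : ∀ b, (V b : 𝔸) ∈ unitary 𝔸)
    (hV : ∀ b, ‖((V b : 𝔸ˣ) : 𝔸)‖ ≤ 1) (hV' : ∀ b, ‖(((V b)⁻¹ : 𝔸ˣ) : 𝔸)‖ ≤ 1) {ε : ℝ} (hε0 : 0 ≤ ε) (hε : ε ≤ 1 / 8)
    (hWc : ∀ x ∈ offAxis L c, ‖((loopW L (fun U : ZdEdge d → 𝔸ˣ => gammaT L U) V c x : 𝔸ˣ) : 𝔸) - 1‖ ≤ ε)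
    (hbud : (L : ℝ) ^ d / L * (24 * ε) < 1) :
    ∃ Ψ : (LinearMap.ker ((TΓ L V c : realSub (κΓ 𝔸 L c) →L[ℝ] realSub (κ𝔸 𝔸)) :
        realSub (κΓ 𝔸 L c) →ₗ[ℝ] realSub (κ𝔸 𝔸)) × realSub (κ𝔸 𝔸)) ≃L[ℝ] realSub (κΓ 𝔸 L c),
      ∀ y, (Ψ.symm y).2 = TΓ L V c y := by
  have hLr : (0 : ℝ) < L := by exact_mod_cast hL
  have hR : (0 : ℝ) < 1 / (2816 * ((d : ℝ) + 1) * L) := by positivity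
  have hF : HasFDerivAt (QtΓ L V c) (fderiv ℂ (QtΓ L V c) 0) 0 :=
    ((analyticOnNhd_Qtilde_gammaT hL hV hV' hε0 hε hWc) 0 (mem_ball_self hR)).differentiableAt.hasFDerivAt
  obtain ⟨Ψ, -, hΨ⟩ := exists_splitting_of_rightInverse (TΓ L V c) (hΓAt hL V hε0 hε c hWc hV hV' hbud)
    (realForm_rightInverse (fderiv ℂ (QtΓ L V c) 0) (fderiv_hopΓAt hL V hε0 hε c hWc hV hV' hbud hF)
      (norm_hopΓAt_le hL V hε0 hε c hWc hV hV' hbud)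
      (hopΓAt_star hL V hε0 hε c hWc hV hV' hbud (hGenAt_star_gammaT_unitary hL V hε0 hε c hWc hV hV' hbud hVu))
      (incl_reP_of_fixed κΓ_invol) (conj_incl (κ𝔸 𝔸)) (reP_incl κ𝔸_invol))
  exact ⟨Ψ, hΨ⟩

variable [FiniteDimensional ℂ 𝔸] [MeasurableSpace 𝔸] [BorelSpace 𝔸] [MeasurableSpace (↥(qppBonds L c) → 𝔸)]
  [BorelSpace (↥(qppBonds L c) → 𝔸)]

/-- **NE7c — (LR)_j REAL-FORM CHART DATA FOR [B7] (15) AT THE COARSE BOND `c` FROM THE LOOP REGIME AT `c` ONLY.**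
Row S52's END `realForm_chartData_gammaT` — the SAME six clauses (`D̃` in the ball `4·(Mq R 1)·εw²`, print's
fixed-point equation `C̃(B − h D̃(B)) = D̃(B)`, `Q̃(B − h D̃(B)) = DQ̃(0)B`; the real chart measurable, injective on the
Hermitian window, with derivative `id − h ∘ (reP ∘ DD̃↾ℝ ∘ incl)` within it, linearizing `TΓ + C̃_ℝ` into
`(Ψ.symm ·).2`) — with the regularity binder LOCATED: `ε`-regular off-axis block loops AT `c` (not at every coarse bond
of `ℤᵈ`); unitarity, unit bounds, the Neumann budget and the window numerics as in S52.  S46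
`exists_realForm_chartData_of_Q` BY NAME with (Q1)(Q3) := S49 f2, (Q4) := S52 §1 `QtΓ_conj`, `hop` := §2. [folklore] -/
theorem realForm_chartData_gammaT_local (hL : 0 < L) {V : ZdEdge d → 𝔸ˣ} (hVu : ∀ b, (V b : 𝔸) ∈ unitary 𝔸)
    (hV : ∀ b, ‖((V b : 𝔸ˣ) : 𝔸)‖ ≤ 1) (hV' : ∀ b, ‖(((V b)⁻¹ : 𝔸ˣ) : 𝔸)‖ ≤ 1) {ε : ℝ} (hε0 : 0 ≤ ε) (hε : ε ≤ 1 / 8)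
    (hWc : ∀ x ∈ offAxis L c, ‖((loopW L (fun U : ZdEdge d → 𝔸ˣ => gammaT L U) V c x : 𝔸ˣ) : 𝔸) - 1‖ ≤ ε)
    (hbud : (L : ℝ) ^ d / L * (24 * ε) < 1) {εw : ℝ}
    (hq : 9 * Mq (1 / (2816 * ((d : ℝ) + 1) * L)) 1 * (((L : ℝ) ^ d / L) / (1 - (L : ℝ) ^ d / L * (24 * ε))) * εw < 1)
    (hRC : 3 * εw ≤ 1 / (2816 * ((d : ℝ) + 1) * L))
    {Kf : Type*} [NormedAddCommGroup Kf] [NormedSpace ℝ Kf] (Ψ : (Kf × realSub (κ𝔸 𝔸)) ≃L[ℝ] realSub (κΓ 𝔸 L c))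
    (hΨ : ∀ y, (Ψ.symm y).2 = TΓ L V c y) :
    ∃ Dt : (↥(qppBonds L c) → 𝔸) → 𝔸,
      (∀ B : ↥(qppBonds L c) → 𝔸, ‖B‖ < εw →
        Dt B ∈ closedBall (0 : 𝔸) (4 * Mq (1 / (2816 * ((d : ℝ) + 1) * L)) 1 * εw ^ 2) ∧
        nonlin (QtΓ L V c) (B - hopΓAt hL V hε0 hε c hWc hV hV' hbud (Dt B)) = Dt B ∧
        QtΓ L V c (B - hopΓAt hL V hε0 hε c hWc hV hV' hbud (Dt B)) = fderiv ℂ (QtΓ L V c) 0 B) ∧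
      Measurable (fun B : realSub (κΓ 𝔸 L c) => B - hΓAt hL V hε0 hε c hWc hV hV' hbud (DtΓℝ L c Dt εw B)) ∧
      InjOn (fun B : realSub (κΓ 𝔸 L c) => B - hΓAt hL V hε0 hε c hWc hV hV' hbud (DtΓℝ L c Dt εw B)) (winΓ L c εw) ∧
      (∀ B ∈ winΓ L c εw, HasFDerivWithinAt
          (fun B : realSub (κΓ 𝔸 L c) => B - hΓAt hL V hε0 hε c hWc hV hV' hbud (DtΓℝ L c Dt εw B))
          (ContinuousLinearMap.id ℝ (realSub (κΓ 𝔸 L c)) - (hΓAt hL V hε0 hε c hWc hV hV' hbud).comp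
            (reP (κ𝔸 𝔸) κ𝔸_invol ∘L (fderiv ℂ Dt (incl (κΓ 𝔸 L c) B)).restrictScalars ℝ ∘L incl (κΓ 𝔸 L c)))
          (winΓ L c εw) B) ∧
      ∀ B ∈ winΓ L c εw,
        TΓ L V c (B - hΓAt hL V hε0 hε c hWc hV hV' hbud (DtΓℝ L c Dt εw B)) +
          (fun y => reP (κ𝔸 𝔸) κ𝔸_invol (nonlin (QtΓ L V c) (incl (κΓ 𝔸 L c) y)))
            (B - hΓAt hL V hε0 hε c hWc hV hV' hbud (DtΓℝ L c Dt εw B)) = (Ψ.symm B).2 := by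
  have hLr : (0 : ℝ) < L := by exact_mod_cast hL
  have hR : (0 : ℝ) < 1 / (2816 * ((d : ℝ) + 1) * L) := by positivity
  have hQa := analyticOnNhd_Qtilde_gammaT hL hV hV' hε0 hε hWc (c := c)
  have hQM : ∀ B ∈ ball (0 : ↥(qppBonds L c) → 𝔸) (1 / (2816 * ((d : ℝ) + 1) * L)), ‖QtΓ L V c B‖ ≤ 1 := by
    intro B hB
    rw [mem_ball_zero_iff] at hB
    refine (norm_Qtilde_gammaT_le hL hV hV' hε0 hε hWc hB).trans ?_
    have hK : (0 : ℝ) < 2816 * ((d : ℝ) + 1) * L := by positivity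
    calc 2816 * ((d : ℝ) + 1) * L * ‖B‖ ≤ 2816 * ((d : ℝ) + 1) * L * (1 / (2816 * ((d : ℝ) + 1) * L)) :=
          mul_le_mul_of_nonneg_left hB.le hK.le
      _ = 1 := mul_one_div_cancel hK.ne'
  have hF : HasFDerivAt (QtΓ L V c) (fderiv ℂ (QtΓ L V c) 0) 0 :=
    (hQa 0 (mem_ball_self hR)).differentiableAt.hasFDerivAt
  exact exists_realForm_chartData_of_Q κ𝔸_invol κΓ_invol hR hQa (QtΓ_zero L V c) hQM
    (QtΓ_conj hL hVu hV hV' hε0 hε hWc) (fderiv_hopΓAt hL V hε0 hε c hWc hV hV' hbud hF) (hop_bound_nonneg hL hbud)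
    (norm_hopΓAt_le hL V hε0 hε c hWc hV hV' hbud)
    (hopΓAt_star hL V hε0 hε c hWc hV hV' hbud (hGenAt_star_gammaT_unitary hL V hε0 hε c hWc hV hV' hbud hVu))
    hq hRC Ψ hΨ


/-- **THE SAME, FULLY EXPLICIT — the located loop binder + unitarity and NOTHING ELSE** (S52's `_explicit`, located):
the window radius CHOSEN, `εw := R²∕(18b + 3R + 1)` (`R = 1∕(2816(d+1)L)`, `b = (Lᵈ∕L)∕(1 − (Lᵈ∕L)·24ε)`, S52 f1
`window_ok`), the real splitting `Ψ` SUPPLIED (`exists_splitting_gammaT_local`). [folklore] -/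
theorem realForm_chartData_gammaT_local_explicit (hL : 0 < L) {V : ZdEdge d → 𝔸ˣ} (hVu : ∀ b, (V b : 𝔸) ∈ unitary 𝔸)
    (hV : ∀ b, ‖((V b : 𝔸ˣ) : 𝔸)‖ ≤ 1) (hV' : ∀ b, ‖(((V b)⁻¹ : 𝔸ˣ) : 𝔸)‖ ≤ 1) {ε : ℝ} (hε0 : 0 ≤ ε) (hε : ε ≤ 1 / 8)
    (hWc : ∀ x ∈ offAxis L c, ‖((loopW L (fun U : ZdEdge d → 𝔸ˣ => gammaT L U) V c x : 𝔸ˣ) : 𝔸) - 1‖ ≤ ε)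
    (hbud : (L : ℝ) ^ d / L * (24 * ε) < 1) :
    ∃ (εw : ℝ) (Ψ : (LinearMap.ker ((TΓ L V c : realSub (κΓ 𝔸 L c) →L[ℝ] realSub (κ𝔸 𝔸)) :
        realSub (κΓ 𝔸 L c) →ₗ[ℝ] realSub (κ𝔸 𝔸)) × realSub (κ𝔸 𝔸)) ≃L[ℝ] realSub (κΓ 𝔸 L c))
      (Dt : (↥(qppBonds L c) → 𝔸) → 𝔸),
      εw = (1 / (2816 * ((d : ℝ) + 1) * L)) ^ 2 /
          (18 * (((L : ℝ) ^ d / L) / (1 - (L : ℝ) ^ d / L * (24 * ε))) + 3 * (1 / (2816 * ((d : ℝ) + 1) * L)) + 1) ∧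
      (∀ y, (Ψ.symm y).2 = TΓ L V c y) ∧
      (∀ B : ↥(qppBonds L c) → 𝔸, ‖B‖ < εw →
        Dt B ∈ closedBall (0 : 𝔸) (4 * Mq (1 / (2816 * ((d : ℝ) + 1) * L)) 1 * εw ^ 2) ∧
        nonlin (QtΓ L V c) (B - hopΓAt hL V hε0 hε c hWc hV hV' hbud (Dt B)) = Dt B ∧
        QtΓ L V c (B - hopΓAt hL V hε0 hε c hWc hV hV' hbud (Dt B)) = fderiv ℂ (QtΓ L V c) 0 B) ∧
      Measurable (fun B : realSub (κΓ 𝔸 L c) => B - hΓAt hL V hε0 hε c hWc hV hV' hbud (DtΓℝ L c Dt εw B)) ∧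
      InjOn (fun B : realSub (κΓ 𝔸 L c) => B - hΓAt hL V hε0 hε c hWc hV hV' hbud (DtΓℝ L c Dt εw B)) (winΓ L c εw) ∧
      (∀ B ∈ winΓ L c εw, HasFDerivWithinAt
          (fun B : realSub (κΓ 𝔸 L c) => B - hΓAt hL V hε0 hε c hWc hV hV' hbud (DtΓℝ L c Dt εw B))
          (ContinuousLinearMap.id ℝ (realSub (κΓ 𝔸 L c)) - (hΓAt hL V hε0 hε c hWc hV hV' hbud).comp
            (reP (κ𝔸 𝔸) κ𝔸_invol ∘L (fderiv ℂ Dt (incl (κΓ 𝔸 L c) B)).restrictScalars ℝ ∘L incl (κΓ 𝔸 L c)))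
          (winΓ L c εw) B) ∧
      ∀ B ∈ winΓ L c εw,
        TΓ L V c (B - hΓAt hL V hε0 hε c hWc hV hV' hbud (DtΓℝ L c Dt εw B)) +
          (fun y => reP (κ𝔸 𝔸) κ𝔸_invol (nonlin (QtΓ L V c) (incl (κΓ 𝔸 L c) y)))
            (B - hΓAt hL V hε0 hε c hWc hV hV' hbud (DtΓℝ L c Dt εw B)) = (Ψ.symm B).2 := by
  have hLr : (0 : ℝ) < L := by exact_mod_cast hL
  have hR : (0 : ℝ) < 1 / (2816 * ((d : ℝ) + 1) * L) := by positivity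
  obtain ⟨hq, hRC⟩ := window_ok hR (hop_bound_nonneg hL hbud)
  obtain ⟨Ψ, hΨ⟩ := exists_splitting_gammaT_local hL hVu hV hV' hε0 hε hWc hbud
  obtain ⟨Dt, h⟩ := realForm_chartData_gammaT_local hL hVu hV hV' hε0 hε hWc hbud hq hRC Ψ hΨ
  exact ⟨_, Ψ, Dt, rfl, hΨ, h⟩

/-- the located `hop` on print's regular box (`ε := ω(ε₀)`, thresholds `thresholds_of_small`). [folklore] -/
abbrev hopΓBox (hL : 0 < L) (hd : 1 ≤ d) (V : ZdEdge d → 𝔸ˣ) (hV : ∀ b, ‖((V b : 𝔸ˣ) : 𝔸)‖ ≤ 1)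
    (hV' : ∀ b, ‖(((V b)⁻¹ : 𝔸ˣ) : 𝔸)‖ ≤ 1) {ε₀ : ℝ} (hε₀ : 0 ≤ ε₀)
    (hsmall : 24 * (d : ℝ) * (L : ℝ) ^ (d + 1) * ε₀ < 1) (c : ZdEdge d)
    (h44c : ∀ (p : Fin d → ℤ) (i j : Fin d), i ≠ j → blockBase L c.1 ≤ p →
      p + Pi.single i 1 + Pi.single j 1 ≤ blockBase L c.1 + pairTop L c.2 →
      ‖((plaquetteHolonomyZd V p i j : 𝔸ˣ) : 𝔸) - 1‖ ≤ ε₀) : 𝔸 →ₗ[ℂ] (↥(qppBonds L c) → 𝔸) :=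
  hopΓAt hL V (omegaC_nonneg hL hd hε₀) (thresholds_of_small hL hd hε₀ hsmall).1 c
    (loopsAt_of_box hL V hV hV' hε₀ c h44c) hV hV' (thresholds_of_small hL hd hε₀ hsmall).2

/-- its real form. [folklore] -/
abbrev hΓBox (hL : 0 < L) (hd : 1 ≤ d) (V : ZdEdge d → 𝔸ˣ) (hV : ∀ b, ‖((V b : 𝔸ˣ) : 𝔸)‖ ≤ 1)
    (hV' : ∀ b, ‖(((V b)⁻¹ : 𝔸ˣ) : 𝔸)‖ ≤ 1) {ε₀ : ℝ} (hε₀ : 0 ≤ ε₀)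
    (hsmall : 24 * (d : ℝ) * (L : ℝ) ^ (d + 1) * ε₀ < 1) (c : ZdEdge d)
    (h44c : ∀ (p : Fin d → ℤ) (i j : Fin d), i ≠ j → blockBase L c.1 ≤ p →
      p + Pi.single i 1 + Pi.single j 1 ≤ blockBase L c.1 + pairTop L c.2 →
      ‖((plaquetteHolonomyZd V p i j : 𝔸ˣ) : 𝔸) - 1‖ ≤ ε₀) : realSub (κ𝔸 𝔸) →L[ℝ] realSub (κΓ 𝔸 L c) :=
  hΓAt hL V (omegaC_nonneg hL hd hε₀) (thresholds_of_small hL hd hε₀ hsmall).1 c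
    (loopsAt_of_box hL V hV hV' hε₀ c h44c) hV hV' (thresholds_of_small hL hd hε₀ hsmall).2

/-- **THE SAME FROM PRINT'S PLAQUETTE REGULARITY ON THE TWO-BLOCK BOX OF `c` ALONE** ([B12] p. 254 ∕ B11 (19)–(21)
TYPE, LOCATED: plaquettes with corners in `[L c₋, L c₋ + pairTop L c.2]` only; `24·d·L^{d+1}·ε₀ < 1`); window numerics
with `b := (Lᵈ∕L)∕(1 − (Lᵈ∕L)·24ω(ε₀))`. [folklore] -/
theorem realForm_chartData_gammaT_local_regular (hL : 0 < L) (hd : 1 ≤ d) {V : ZdEdge d → 𝔸ˣ}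
    (hVu : ∀ b, (V b : 𝔸) ∈ unitary 𝔸)
    (hV : ∀ b, ‖((V b : 𝔸ˣ) : 𝔸)‖ ≤ 1) (hV' : ∀ b, ‖(((V b)⁻¹ : 𝔸ˣ) : 𝔸)‖ ≤ 1) {ε₀ : ℝ} (hε₀ : 0 ≤ ε₀)
    (hsmall : 24 * (d : ℝ) * (L : ℝ) ^ (d + 1) * ε₀ < 1)
    (h44c : ∀ (p : Fin d → ℤ) (i j : Fin d), i ≠ j → blockBase L c.1 ≤ p →
      p + Pi.single i 1 + Pi.single j 1 ≤ blockBase L c.1 + pairTop L c.2 →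
      ‖((plaquetteHolonomyZd V p i j : 𝔸ˣ) : 𝔸) - 1‖ ≤ ε₀)
    {εw : ℝ}
    (hq : 9 * Mq (1 / (2816 * ((d : ℝ) + 1) * L)) 1 *
      (((L : ℝ) ^ d / L) / (1 - (L : ℝ) ^ d / L * (24 * omegaC d L ε₀))) * εw < 1)
    (hRC : 3 * εw ≤ 1 / (2816 * ((d : ℝ) + 1) * L))
    {Kf : Type*} [NormedAddCommGroup Kf] [NormedSpace ℝ Kf] (Ψ : (Kf × realSub (κ𝔸 𝔸)) ≃L[ℝ] realSub (κΓ 𝔸 L c))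
    (hΨ : ∀ y, (Ψ.symm y).2 = TΓ L V c y) :
    ∃ Dt : (↥(qppBonds L c) → 𝔸) → 𝔸,
      (∀ B : ↥(qppBonds L c) → 𝔸, ‖B‖ < εw →
        Dt B ∈ closedBall (0 : 𝔸) (4 * Mq (1 / (2816 * ((d : ℝ) + 1) * L)) 1 * εw ^ 2) ∧
        nonlin (QtΓ L V c) (B - hopΓBox hL hd V hV hV' hε₀ hsmall c h44c (Dt B)) = Dt B ∧
        QtΓ L V c (B - hopΓBox hL hd V hV hV' hε₀ hsmall c h44c (Dt B)) = fderiv ℂ (QtΓ L V c) 0 B) ∧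
      Measurable (fun B : realSub (κΓ 𝔸 L c) =>
        B - hΓBox hL hd V hV hV' hε₀ hsmall c h44c (DtΓℝ L c Dt εw B)) ∧
      InjOn (fun B : realSub (κΓ 𝔸 L c) =>
        B - hΓBox hL hd V hV hV' hε₀ hsmall c h44c (DtΓℝ L c Dt εw B)) (winΓ L c εw) ∧
      (∀ B ∈ winΓ L c εw, HasFDerivWithinAt
          (fun B : realSub (κΓ 𝔸 L c) => B - hΓBox hL hd V hV hV' hε₀ hsmall c h44c (DtΓℝ L c Dt εw B))
          (ContinuousLinearMap.id ℝ (realSub (κΓ 𝔸 L c)) - (hΓBox hL hd V hV hV' hε₀ hsmall c h44c).comp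
            (reP (κ𝔸 𝔸) κ𝔸_invol ∘L (fderiv ℂ Dt (incl (κΓ 𝔸 L c) B)).restrictScalars ℝ ∘L incl (κΓ 𝔸 L c)))
          (winΓ L c εw) B) ∧
      ∀ B ∈ winΓ L c εw,
        TΓ L V c (B - hΓBox hL hd V hV hV' hε₀ hsmall c h44c (DtΓℝ L c Dt εw B)) +
          (fun y => reP (κ𝔸 𝔸) κ𝔸_invol (nonlin (QtΓ L V c) (incl (κΓ 𝔸 L c) y)))
            (B - hΓBox hL hd V hV hV' hε₀ hsmall c h44c (DtΓℝ L c Dt εw B)) = (Ψ.symm B).2 :=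
  realForm_chartData_gammaT_local hL hVu hV hV' (omegaC_nonneg hL hd hε₀) (thresholds_of_small hL hd hε₀ hsmall).1
    (loopsAt_of_box hL V hV hV' hε₀ c h44c) (thresholds_of_small hL hd hε₀ hsmall).2 hq hRC Ψ hΨ

end End

/-! ## §4 The co-test reading: the located binder from ANY co-tested plaquette set containing the box -/

section CoTests

variable {c : ZdEdge d}

omit [NormedAlgebra ℂ 𝔸] [NormOneClass 𝔸] [CompleteSpace 𝔸] in
/-- **THE LOCATED REGULARITY BINDER READ OFF BARE UNIT-PLAQUETTE CO-TESTS** on any plaquette set `P` containing the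
two-block box of `c` (at a live slot: the unit plaquettes of `□^{∼4}` ⊇ `B(c₋) ∪ B(c₊)` for every coarse bond `c` of
`□`; their indicators are x-independent history factors of the (2.18)-term).  The identification of the background with
Bałaban's `V = Q(U_{j,□})` and the threshold `ε₀ := C(L)ε_j` are [dict] ∕ displayed (N-ne7cp1-g32-2).  (The GLOBAL
binder of S52∕S60 is the case `P := univ` — the located END loses nothing.) [folklore] -/
theorem h44c_of_cotests {V : ZdEdge d → 𝔸ˣ} {ε₀ : ℝ} {P : Set (Fin d → ℤ)}
    (hP : ∀ p : Fin d → ℤ, ∀ i j : Fin d, i ≠ j → blockBase L c.1 ≤ p →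
      p + Pi.single i 1 + Pi.single j 1 ≤ blockBase L c.1 + pairTop L c.2 → p ∈ P)
    (hco : ∀ p ∈ P, ∀ i j : Fin d, i ≠ j → ‖((plaquetteHolonomyZd V p i j : 𝔸ˣ) : 𝔸) - 1‖ ≤ ε₀) :
    ∀ (p : Fin d → ℤ) (i j : Fin d), i ≠ j → blockBase L c.1 ≤ p →
      p + Pi.single i 1 + Pi.single j 1 ≤ blockBase L c.1 + pairTop L c.2 →
      ‖((plaquetteHolonomyZd V p i j : 𝔸ˣ) : 𝔸) - 1‖ ≤ ε₀ :=
  fun p i j hij hlo hhi => hco p (hP p i j hij hlo hhi) i j hij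

end CoTests


/-! ## §5 NON-VACUITY (crew rule G-1, test (x1)): the located binders are jointly inhabited -/

section NonVacuity

omit [NormedAlgebra ℂ 𝔸] [CompleteSpace 𝔸] in
/-- **NON-VACUITY AT THE FLAT CONFIGURATION**: at `V ≡ 1` every hypothesis of `realForm_chartData_gammaT_local_regular`
on the background holds with `ε₀ = 0` — unit bounds, the LOCATED plaquette binder on the box of ANY coarse bond `c`
(`B12PlaquetteLoop267.flat_regular`, weakened to the box), the smallness `24dL^{d+1}·0 < 1`; unitarity is `one_mem`;
the window numerics `hq`∕`hRC` are inhabited by S52 f1 `window_ok` and the splitting by `exists_splitting_gammaT_local`.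
The located binder family is WEAKER than S52∕S60's global one (case `P := univ` of §4), so every inhabitant of theirs
(`B12AverageCorridor267.flat_hypotheses`) is one of ours. [folklore] -/
theorem nonvacuity_flat (L : ℕ) (c : ZdEdge d) :
    (∀ b, ‖(((1 : ZdEdge d → 𝔸ˣ) b : 𝔸ˣ) : 𝔸)‖ ≤ 1) ∧
    (∀ b, ‖((((1 : ZdEdge d → 𝔸ˣ) b)⁻¹ : 𝔸ˣ) : 𝔸)‖ ≤ 1) ∧
    (∀ (p : Fin d → ℤ) (i j : Fin d), i ≠ j → blockBase L c.1 ≤ p →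
      p + Pi.single i 1 + Pi.single j 1 ≤ blockBase L c.1 + pairTop L c.2 →
      ‖((plaquetteHolonomyZd (1 : ZdEdge d → 𝔸ˣ) p i j : 𝔸ˣ) : 𝔸) - 1‖ ≤ (0 : ℝ)) ∧
    24 * (d : ℝ) * (L : ℝ) ^ (d + 1) * (0 : ℝ) < 1 := by
  obtain ⟨h1, h2, h3, -, -⟩ := B12PlaquetteLoop267.flat_regular (d := d) (𝔸 := 𝔸) L
  exact ⟨h1, h2, fun p i j hij _ _ => h3 p i j hij, by norm_num⟩

omit [NormedAlgebra ℂ 𝔸] [NormOneClass 𝔸] [CompleteSpace 𝔸] in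
/-- … and the flat background is unitary (any `StarRing`): `(1 : 𝔸) ∈ unitary 𝔸` bondwise. [folklore] -/
theorem flat_unitary [StarRing 𝔸] : ∀ b, (((1 : ZdEdge d → 𝔸ˣ) b : 𝔸ˣ) : 𝔸) ∈ unitary 𝔸 :=
  fun _ => by rw [Pi.one_apply, Units.val_one]; exact one_mem _

end NonVacuity

end Summit.QuantumFields.BalabanUV.T4Continuum.ShellMeasureLinearizedGammaTLocal

end
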